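import Literature.NumberTheory.Sieve.QuadraticRootsPrimeModuliDFIPoincare
import Literature.NumberTheory.LFunctions.KloostermanWeilPrimeProofs
import HarnessLib

/-!
# The off-diagonal terms of the unfolded norm: Kloosterman sums and Weil's bound (DFI 1995, Prop. 4, support file)

Topic `Literature/NumberTheory/Sieve`.  Fifth support file of the elementary proof of Proposition 4
of W. Duke, J. B. Friedlander, H. Iwaniec, *Equidistribution of roots of a quadratic congruence to
prime moduli*, Ann. of Math. 141 (1995).  `…DFIPoincareNorm.lean` bounds the square of the
`L²`-norm of the Poincaré series `P_ψ` of a strip kernel `ψ(z) = Φ(Im z) e(η Re z)` on `Γ₀(q)∖ℍ` by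
`∫_{strip} |ψ|² dμ + ∑_{c ≥ 1, q ∣ c} |∑_{d mod c, (c,d)=1} ∫_ℍ conj(ψ ∘ γ_{c,d}) ψ dμ|`,
`γ_{c,d} = (a b; c d) ∈ SL₂(ℤ)`.  Here the inner integrals are evaluated and bounded — this is the
geometric side of Kuznetsov's formula for the pair `(P_ψ, P_ψ)`, written out by hand:

* the **hyperbolic area of a coordinate rectangle** `[x₁,x₂] × [Y₁,Y₂] ⊆ ℍ` is at most
  `(x₂ - x₁)(Y₂ - Y₁)/Y₁²` (`volume_coe_preimage_reProdIm_le`), whence the diagonal term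
  `∫_{strip} |ψ|² dμ ≤ B² (Y₂ - Y₁)/Y₁²` (`setIntegral_strip_norm_sq_le`);
* for `γ = (a b; c d)`, `c ≥ 1`: `γz = a/c - 1/(c(cz + d))`, so with `v = z + d/c`,
  **`conj(ψ(γz)) ψ(z) = e(-η(a + d)/c) K_c(v)`** with
  `K_c(v) = conj Φ(Im v/(c²|v|²)) Φ(Im v) e(η Re v (1 + 1/(c²|v|²)))` independent of `d`
  (`conj_stripKernel_smul_mul_eq`), and by the translation invariance of `dμ`
  `∫_ℍ conj(ψ ∘ γ) ψ dμ = e(-η(a+d)/c) I_c`, `I_c = ∫_ℍ K_c dμ` (`integral_conj_stripKernel_smul_mul_eq`);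
* `K_c` is supported in `|Re v| ≤ (Y₂/Y₁)^{1/2}/c`, `Y₁ ≤ Im v ≤ Y₂` and vanishes identically for
  `c > 1/Y₁`, so `|I_c| ≤ 2 B² (Y₂/Y₁)^{1/2} (Y₂ - Y₁)/(c Y₁²)` and `I_c = 0` for `c Y₁ > 1`
  (`norm_integral_offDiagKernel_le`, `integral_offDiagKernel_eq_zero`);
* `a ≡ d⁻¹ (mod c)`, so summing over `d mod c` gives the **Kloosterman sum**:
  `∑_{d} e(-η(a_d + d)/c) = S(-η, -η; c)` (`sum_phase_eq_kloostermanSum`), and with **Weil's bound**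
  (the tree's PROVED `weil_kloosterman_bound_holds`)
  `|∑_{d mod c} ∫_ℍ conj(ψ ∘ γ_{c,d}) ψ dμ| ≤ τ(c) (η,c)^{1/2} c^{1/2} |I_c|`
  (`norm_sum_integral_conj_stripKernel_smul_mul_le`).

Everything here is proved; no statement of the paper is vendored (no new named fact, no definition).

## References

* W. Duke, J. B. Friedlander, H. Iwaniec, Ann. of Math. (2) 141 (1995), 423–441, §3, (21)–(23).
  [cite: DukeFriedlanderIwaniec1995, (21)–(23) p. 430–431]
* H. Iwaniec, *Spectral Methods of Automorphic Forms*, 2nd ed., GSM 53 (2002), §2.3, §3.2; and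
  (2.25) (Weil's bound). [cite: Iwaniec2002, §3.2 and (2.25)]
-/

noncomputable section

namespace Literature.NumberTheory.Sieve

open scoped MatrixGroups UpperHalfPlane Real _root_.Topology _root_.ENNReal _root_.NNReal ComplexConjugate
open _root_.UpperHalfPlane _root_.MeasureTheory _root_.Set _root_.Filter _root_.Complex
open _root_.ModularGroup (T)
open _root_.Literature.NumberTheory.Automorphic
open _root_.Literature.NumberTheory.LFunctions (kloostermanSum weil_kloosterman_bound_holds sum_zmod_eq_sum_range)

namespace DFI1995

variable {q : ℕ}

/-! ### Hyperbolic area of coordinate rectangles -/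

/-- **The hyperbolic area of a coordinate rectangle**: for `x₁ ≤ x₂` and `0 < Y₁`,
`μ({x₁ ≤ Re ≤ x₂, Y₁ ≤ Im ≤ Y₂}) ≤ (x₂ - x₁)(Y₂ - Y₁)/Y₁²` (`dμ = y⁻² dx dy ≤ Y₁⁻² dx dy` there;
both sides vanish when `Y₂ < Y₁`). [cite: Iwaniec2002, (1.8), PDF p. 10] -/
theorem volume_coe_preimage_reProdIm_le {x₁ x₂ Y₁ : ℝ} (Y₂ : ℝ) (hx : x₁ ≤ x₂) (hY₁ : 0 < Y₁) :
    volume (((↑) : ℍ → ℂ) ⁻¹' (Icc x₁ x₂ ×ℂ Icc Y₁ Y₂)) ≤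
      ENNReal.ofReal ((x₂ - x₁) * (Y₂ - Y₁) / Y₁ ^ 2) := by
  set A : Set ℂ := Icc x₁ x₂ ×ℂ Icc Y₁ Y₂ with hA
  have hAm : MeasurableSet A := (measurableSet_Icc.preimage measurable_re).inter
    (measurableSet_Icc.preimage measurable_im)
  have himage : ((↑) : ℍ → ℂ) '' (((↑) : ℍ → ℂ) ⁻¹' A) = A := by
    rw [image_preimage_eq_inter_range]
    refine inter_eq_left.2 fun w hw => ?_
    exact ⟨⟨w, lt_of_lt_of_le hY₁ hw.2.1⟩, rfl⟩
  rw [UpperHalfPlane.volume_eq_lintegral, himage]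
  -- bound the density by `Y₁⁻²` on `A`
  have hle : ∀ z ∈ A, (((1 / ‖z.im‖₊) ^ 2 : ℝ≥0) : ℝ≥0∞) ≤ ENNReal.ofReal (1 / Y₁ ^ 2) := by
    rintro z ⟨-, hz1, -⟩
    have hzpos : 0 < z.im := lt_of_lt_of_le hY₁ hz1
    rw [ENNReal.ofReal, ENNReal.coe_le_coe]
    have e : ((1 / ‖z.im‖₊) ^ 2 : ℝ≥0) = Real.toNNReal (1 / z.im ^ 2) := by
      apply NNReal.eq
      rw [Real.coe_toNNReal _ (by positivity)]
      simp [abs_of_pos hzpos]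
    rw [e]
    exact Real.toNNReal_le_toNNReal (one_div_le_one_div_of_le (by positivity)
      (by nlinarith))
  calc ∫⁻ z in A, (((1 / ‖z.im‖₊) ^ 2 : ℝ≥0) : ℝ≥0∞)
      ≤ ∫⁻ z in A, ENNReal.ofReal (1 / Y₁ ^ 2) := setLIntegral_mono' hAm hle
    _ = ENNReal.ofReal (1 / Y₁ ^ 2) * volume A := setLIntegral_const A _
    _ = ENNReal.ofReal (1 / Y₁ ^ 2) * (ENNReal.ofReal (x₂ - x₁) * ENNReal.ofReal (Y₂ - Y₁)) := by
        congr 1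
        have e : (Complex.measurableEquivRealProd : ℂ → ℝ × ℝ) ⁻¹' (Icc x₁ x₂ ×ˢ Icc Y₁ Y₂) =
            Icc x₁ x₂ ×ℂ Icc Y₁ Y₂ := rfl
        rw [hA, ← e, Complex.volume_preserving_equiv_real_prod.measure_preimage_equiv,
          show (volume : Measure (ℝ × ℝ)) = (volume : Measure ℝ).prod volume from rfl,
          Measure.prod_prod, Real.volume_Icc, Real.volume_Icc]
    _ = ENNReal.ofReal ((x₂ - x₁) * (Y₂ - Y₁) / Y₁ ^ 2) := by
        rw [← ENNReal.ofReal_mul (by linarith), ← ENNReal.ofReal_mul (by positivity)]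
        congr 1
        field_simp

/-- **The diagonal term**: `∫_{strip} |ψ|² dμ ≤ B² (Y₂ - Y₁)/Y₁²` for a kernel bounded by `B` and
supported in the heights `[Y₁, Y₂]`. [folklore] -/
theorem setIntegral_strip_norm_sq_le {φ : ℍ → ℂ} {Y₁ Y₂ B : ℝ} (hY₁ : 0 < Y₁) (hY : Y₁ ≤ Y₂)
    (hsupp : ∀ z : ℍ, φ z ≠ 0 → Y₁ ≤ z.im ∧ z.im ≤ Y₂) (hbd : ∀ z : ℍ, ‖φ z‖ ≤ B) :
    ∫ w in strip, ‖φ w‖ ^ 2 ≤ B ^ 2 * ((Y₂ - Y₁) / Y₁ ^ 2) := by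
  set R : Set ℍ := ((↑) : ℍ → ℂ) ⁻¹' (Icc 0 1 ×ℂ Icc Y₁ Y₂) with hR
  have hRm : MeasurableSet R := UpperHalfPlane.measurable_coe
    ((measurableSet_Icc.preimage measurable_re).inter (measurableSet_Icc.preimage measurable_im))
  have hvol := volume_coe_preimage_reProdIm_le Y₂ (zero_le_one) hY₁
  rw [sub_zero, one_mul] at hvol
  have hvol' : volume R < ⊤ := lt_of_le_of_lt hvol ENNReal.ofReal_lt_top
  -- `|φ|² ≤ B² 𝟙_R` on the strip
  have hle : ∀ w ∈ strip, ‖φ w‖ ^ 2 ≤ R.indicator (fun _ => B ^ 2) w := by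
    intro w hw
    by_cases h : φ w = 0
    · rw [h, norm_zero, zero_pow two_ne_zero]
      exact indicator_nonneg (fun _ _ => sq_nonneg B) w
    · have hmem : w ∈ R := ⟨⟨hw.1, hw.2.le⟩, hsupp w h⟩
      rw [indicator_of_mem hmem]
      exact pow_le_pow_left₀ (norm_nonneg _) (hbd w) 2
  have hint : IntegrableOn (R.indicator fun _ => B ^ 2) strip volume :=
    ((integrable_indicator_iff hRm).2 (integrableOn_const hvol'.ne)).integrableOn
  calc ∫ w in strip, ‖φ w‖ ^ 2 ≤ ∫ w in strip, R.indicator (fun _ => B ^ 2) w := by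
        refine integral_mono_of_nonneg ?_ hint ?_
        · exact Eventually.of_forall fun w => sq_nonneg _
        · exact (ae_restrict_iff' measurableSet_strip).2 (Eventually.of_forall hle)
    _ ≤ ∫ w, R.indicator (fun _ => B ^ 2) w :=
        setIntegral_le_integral ((integrable_indicator_iff hRm).2 (integrableOn_const hvol'.ne))
          (Eventually.of_forall fun w => indicator_nonneg (fun _ _ => sq_nonneg B) w)
    _ = B ^ 2 * (volume R).toReal := by
        rw [integral_indicator_const _ hRm, smul_eq_mul, mul_comm]; rfl
    _ ≤ B ^ 2 * ((Y₂ - Y₁) / Y₁ ^ 2) := by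
        refine mul_le_mul_of_nonneg_left ?_ (sq_nonneg B)
        have := ENNReal.toReal_mono ENNReal.ofReal_ne_top hvol
        rwa [ENNReal.toReal_ofReal (by apply div_nonneg <;> nlinarith)] at this

/-! ### Real translations -/

/-- The real translation `w ↦ w + t` is the action of `(1 t; 0 1) ∈ SL₂(ℝ)`. [folklore] -/
theorem exists_sl_smul_eq_vadd (t : ℝ) : ∃ g : SL(2, ℝ), ∀ w : ℍ, g • w = t +ᵥ w := by
  refine ⟨⟨!![1, t; 0, 1], by simp [Matrix.det_fin_two_of]⟩, fun w => ?_⟩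
  apply UpperHalfPlane.ext
  rw [UpperHalfPlane.coe_specialLinearGroup_apply, UpperHalfPlane.coe_vadd]
  simp only [Matrix.of_apply, Matrix.cons_val', Matrix.cons_val_zero, Matrix.cons_val_one,
    Matrix.cons_val_fin_one, Matrix.empty_val', Algebra.algebraMap_self, RingHom.id_apply]
  push_cast
  ring

/-- **Translation invariance of the hyperbolic integral**: `∫_ℍ K(w + t) dμ = ∫_ℍ K dμ`.
[cite: Iwaniec2002, (1.8)–(1.10), PDF p. 10] -/
theorem integral_comp_vadd (K : ℍ → ℂ) (t : ℝ) : ∫ w, K (t +ᵥ w) = ∫ w, K w := by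
  obtain ⟨g, hg⟩ := exists_sl_smul_eq_vadd t
  have h := (measurePreserving_smul (Matrix.SpecialLinearGroup.toGL g : GL (Fin 2) ℝ)
    (volume : Measure ℍ)).integral_comp (measurableEmbedding_const_smul _) K
  have e : ∀ w : ℍ, (Matrix.SpecialLinearGroup.toGL g : GL (Fin 2) ℝ) • w = t +ᵥ w := fun w => hg w
  simp_rw [e] at h
  exact h

/-! ### The fractional linear transformation `γ = (a b; c d)`, `c > 0` -/

/-- **`γz = a/c - 1/(c(cz + d))`**: for `γ = (a b; c d) ∈ SL₂(ℤ)` with `c ≠ 0` and `v = z + d/c`,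
`γ z = a/c - 1/(c² v)` in `ℂ`. [cite: Iwaniec2002, §2.3 (before (2.16)), PDF p. 30] -/
theorem coe_sl_smul_eq (γ : SL(2, ℤ)) (hc : γ 1 0 ≠ 0) (w : ℍ) :
    ((γ • w : ℍ) : ℂ) = (((γ 0 0 : ℝ) / (γ 1 0 : ℝ) : ℝ) : ℂ) -
      1 / (((γ 1 0 : ℝ) : ℂ) ^ 2 * (((((γ 1 1 : ℝ) / (γ 1 0 : ℝ) : ℝ) +ᵥ w : ℍ) : ℂ))) := by
  have hdet := γ.det_coe
  rw [Matrix.det_fin_two] at hdet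
  have hdetC : ((γ 0 0 : ℤ) : ℂ) * (γ 1 1 : ℤ) - (γ 0 1 : ℤ) * (γ 1 0 : ℤ) = 1 := by exact_mod_cast hdet
  have hc' : ((γ 1 0 : ℤ) : ℂ) ≠ 0 := by exact_mod_cast hc
  have hden : ((γ 1 0 : ℤ) : ℂ) * (w : ℂ) + (γ 1 1 : ℤ) ≠ 0 := by
    intro h0
    have := congrArg Complex.im h0
    simp only [Complex.add_im, Complex.mul_im, Complex.intCast_re, UpperHalfPlane.coe_im,
      Complex.intCast_im, UpperHalfPlane.coe_re, zero_mul, add_zero, Complex.zero_im] at this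
    have hcR : ((γ 1 0 : ℤ) : ℝ) ≠ 0 := by exact_mod_cast hc
    exact absurd this (mul_ne_zero hcR w.im_pos.ne')
  rw [UpperHalfPlane.coe_specialLinearGroup_apply, UpperHalfPlane.coe_vadd]
  simp only [algebraMap_int_eq, Int.coe_castRingHom]
  push_cast
  have hv : (((γ 1 1 : ℤ) : ℂ) / (γ 1 0 : ℤ) + (w : ℂ)) ≠ 0 := by
    intro h0
    apply hden
    have : ((γ 1 0 : ℤ) : ℂ) * (((γ 1 1 : ℤ) : ℂ) / (γ 1 0 : ℤ) + (w : ℂ)) = 0 := by rw [h0, mul_zero]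
    rw [mul_add, mul_div_cancel₀ _ hc'] at this
    linear_combination this
  have hden' : (w : ℂ) * ((γ 1 0 : ℤ) : ℂ) + (γ 1 1 : ℤ) ≠ 0 := by rwa [mul_comm] at hden
  have hv' : (w : ℂ) + ((γ 1 1 : ℤ) : ℂ) / (γ 1 0 : ℤ) ≠ 0 := by rwa [add_comm] at hv
  rw [div_eq_iff hden, sub_mul, div_mul_eq_mul_div, one_div, mul_comm (((γ 1 0 : ℤ) : ℂ) ^ 2)]
  have e2 : ((((γ 1 1 : ℤ) : ℂ) / (γ 1 0 : ℤ) + (w : ℂ)) * ((γ 1 0 : ℤ) : ℂ) ^ 2) =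
      ((γ 1 0 : ℤ) : ℂ) * (((γ 1 0 : ℤ) : ℂ) * (w : ℂ) + (γ 1 1 : ℤ)) := by
    field_simp
    ring
  rw [e2, mul_inv, inv_mul_cancel_right₀ hden]
  field_simp
  linear_combination -hdetC

/-- Real and imaginary parts of `1/(r z)` for real `r`. [folklore] -/
theorem one_div_ofReal_mul_re_im (r : ℝ) (z : ℂ) :
    (1 / ((r : ℂ) * z)).re = z.re / (r * Complex.normSq z) ∧
      (1 / ((r : ℂ) * z)).im = -z.im / (r * Complex.normSq z) := by
  rw [one_div, mul_inv, ← Complex.ofReal_inv, Complex.re_ofReal_mul, Complex.im_ofReal_mul,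
    Complex.inv_re, Complex.inv_im]
  constructor <;> ring

/-- **`Im γz` and `Re γz` through `v = z + d/c`**: `Im γz = Im v/(c²|v|²)`,
`Re γz = a/c - Re v/(c²|v|²)`. [cite: Iwaniec2002, §2.3, PDF p. 30] -/
theorem im_re_sl_smul_eq (γ : SL(2, ℤ)) (hc : γ 1 0 ≠ 0) (w : ℍ) :
    (γ • w).im = (((γ 1 1 : ℝ) / (γ 1 0 : ℝ) : ℝ) +ᵥ w).im /
        ((γ 1 0 : ℝ) ^ 2 * Complex.normSq (((((γ 1 1 : ℝ) / (γ 1 0 : ℝ) : ℝ) +ᵥ w : ℍ) : ℂ))) ∧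
    (γ • w).re = (γ 0 0 : ℝ) / (γ 1 0 : ℝ) - (((γ 1 1 : ℝ) / (γ 1 0 : ℝ) : ℝ) +ᵥ w).re /
        ((γ 1 0 : ℝ) ^ 2 * Complex.normSq (((((γ 1 1 : ℝ) / (γ 1 0 : ℝ) : ℝ) +ᵥ w : ℍ) : ℂ))) := by
  have h := coe_sl_smul_eq γ hc w
  obtain ⟨hre, him⟩ := one_div_ofReal_mul_re_im ((γ 1 0 : ℝ) ^ 2)
    ((((γ 1 1 : ℝ) / (γ 1 0 : ℝ) : ℝ) +ᵥ w : ℍ) : ℂ)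
  constructor
  · rw [← UpperHalfPlane.coe_im, h, Complex.sub_im, Complex.ofReal_im, ← Complex.ofReal_pow, him,
      UpperHalfPlane.coe_im]
    ring
  · rw [← UpperHalfPlane.coe_re, h, Complex.sub_re, Complex.ofReal_re, ← Complex.ofReal_pow, hre,
      UpperHalfPlane.coe_re]

/-- Complex conjugation of a pure phase: `conj e(x) = e(-x)` for real `x`. [folklore] -/
theorem conj_exp_two_pi_I_mul (η : ℤ) (x : ℝ) :
    conj (Complex.exp (2 * π * Complex.I * η * (x : ℂ))) =
      Complex.exp (2 * π * Complex.I * ((-η : ℤ) : ℂ) * (x : ℂ)) := by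
  rw [← Complex.exp_conj]
  congr 1
  simp only [map_mul, Complex.conj_ofReal, Complex.conj_I, map_intCast, map_ofNat]
  push_cast
  ring

/-! ### The off-diagonal kernel -/

/-- **The pointwise identity** `conj(ψ(γz)) ψ(z) = e(-η(a+d)/c) K_c(v)`, `v = z + d/c`, for the strip
kernel `ψ(z) = Φ(Im z) e(η Re z)` and `γ = (a b; c d)`, `c ≠ 0`, with
`K_c(v) = conj Φ(Im v/(c²|v|²)) Φ(Im v) e(η Re v (1 + 1/(c²|v|²)))`.
[cite: DukeFriedlanderIwaniec1995, §3 (the unfolding behind (17), (21))] -/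
theorem conj_stripKernel_smul_mul_eq (Φ : ℝ → ℂ) (η : ℤ) (γ : SL(2, ℤ)) (hc : γ 1 0 ≠ 0) (w : ℍ) :
    conj (Φ (γ • w).im * Complex.exp (2 * π * Complex.I * η * ((γ • w).re : ℂ))) *
        (Φ w.im * Complex.exp (2 * π * Complex.I * η * (w.re : ℂ))) =
      Complex.exp (2 * π * Complex.I * ((-η : ℤ) : ℂ) * ((((γ 0 0 : ℝ) + γ 1 1) / (γ 1 0 : ℝ) : ℝ) : ℂ)) *
        (conj (Φ ((((γ 1 1 : ℝ) / (γ 1 0 : ℝ) : ℝ) +ᵥ w).im /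
            ((γ 1 0 : ℝ) ^ 2 * Complex.normSq (((((γ 1 1 : ℝ) / (γ 1 0 : ℝ) : ℝ) +ᵥ w : ℍ) : ℂ))))) *
          Φ (((γ 1 1 : ℝ) / (γ 1 0 : ℝ) : ℝ) +ᵥ w).im *
          Complex.exp (2 * π * Complex.I * η * (((((γ 1 1 : ℝ) / (γ 1 0 : ℝ) : ℝ) +ᵥ w).re *
            (1 + 1 / ((γ 1 0 : ℝ) ^ 2 *
              Complex.normSq (((((γ 1 1 : ℝ) / (γ 1 0 : ℝ) : ℝ) +ᵥ w : ℍ) : ℂ)))) : ℝ) : ℂ))) := by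
  obtain ⟨him, hre⟩ := im_re_sl_smul_eq γ hc w
  set v : ℍ := (((γ 1 1 : ℝ) / (γ 1 0 : ℝ) : ℝ) +ᵥ w) with hv
  set N : ℝ := Complex.normSq (v : ℂ) with hN
  have hwim : w.im = v.im := by rw [hv, UpperHalfPlane.vadd_im]
  have hwre : w.re = v.re - (γ 1 1 : ℝ) / (γ 1 0 : ℝ) := by
    rw [hv, UpperHalfPlane.vadd_re]; ring
  rw [him, hre, hwim, hwre, map_mul, conj_exp_two_pi_I_mul]
  -- collect the phases
  have key : ∀ (A B : ℂ) (X Y Z W : ℝ), X + W = Y + Z →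
      A * Complex.exp (2 * π * Complex.I * ((-η : ℤ) : ℂ) * (X : ℂ)) *
        (B * Complex.exp (2 * π * Complex.I * η * (Y : ℂ))) =
      Complex.exp (2 * π * Complex.I * ((-η : ℤ) : ℂ) * (Z : ℂ)) *
        (A * B * Complex.exp (2 * π * Complex.I * η * (W : ℂ))) := by
    intro A B X Y Z W hXW
    have hW : (W : ℂ) = Y + Z - X := by
      have : ((X + W : ℝ) : ℂ) = ((Y + Z : ℝ) : ℂ) := by rw [hXW]
      push_cast at this
      linear_combination this
    rw [hW]
    have e1 : Complex.exp (2 * π * Complex.I * η * ((Y : ℂ) + Z - X)) =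
        Complex.exp (2 * π * Complex.I * η * (Y : ℂ)) * Complex.exp (2 * π * Complex.I * η * (Z : ℂ)) *
          Complex.exp (2 * π * Complex.I * ((-η : ℤ) : ℂ) * (X : ℂ)) := by
      rw [← Complex.exp_add, ← Complex.exp_add]; congr 1; push_cast; ring
    have e2 : Complex.exp (2 * π * Complex.I * ((-η : ℤ) : ℂ) * (Z : ℂ)) *
        Complex.exp (2 * π * Complex.I * η * (Z : ℂ)) = 1 := by
      rw [← Complex.exp_add, ← Complex.exp_zero]; congr 1; push_cast; ring
    rw [e1]
    linear_combination (-(A * B * Complex.exp (2 * π * Complex.I * η * (Y : ℂ)) *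
      Complex.exp (2 * π * Complex.I * ((-η : ℤ) : ℂ) * (X : ℂ)))) * e2
  refine key _ _ _ _ _ _ ?_
  ring

/-- **`∫_ℍ conj(ψ ∘ γ) ψ dμ = e(-η(a+d)/c) I_c`** with `I_c = ∫_ℍ K_c dμ` (translation invariance of
`dμ`), for the strip kernel `ψ` and `γ = (a b; c d) ∈ SL₂(ℤ)`, `c ≠ 0`.
[cite: DukeFriedlanderIwaniec1995, §3 (17), (21)] -/
theorem integral_conj_stripKernel_smul_mul_eq (Φ : ℝ → ℂ) (η : ℤ) (γ : SL(2, ℤ)) (hc : γ 1 0 ≠ 0) :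
    ∫ w : ℍ, conj (Φ (γ • w).im * Complex.exp (2 * π * Complex.I * η * ((γ • w).re : ℂ))) *
        (Φ w.im * Complex.exp (2 * π * Complex.I * η * (w.re : ℂ))) =
      Complex.exp (2 * π * Complex.I * ((-η : ℤ) : ℂ) * ((((γ 0 0 : ℝ) + γ 1 1) / (γ 1 0 : ℝ) : ℝ) : ℂ)) *
        ∫ v : ℍ, conj (Φ (v.im / ((γ 1 0 : ℝ) ^ 2 * Complex.normSq (v : ℂ)))) * Φ v.im *
          Complex.exp (2 * π * Complex.I * η *
            ((v.re * (1 + 1 / ((γ 1 0 : ℝ) ^ 2 * Complex.normSq (v : ℂ))) : ℝ) : ℂ)) := by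
  simp_rw [conj_stripKernel_smul_mul_eq Φ η γ hc]
  rw [integral_const_mul]
  congr 1
  exact integral_comp_vadd (fun v : ℍ => conj (Φ (v.im / ((γ 1 0 : ℝ) ^ 2 * Complex.normSq (v : ℂ)))) *
    Φ v.im * Complex.exp (2 * π * Complex.I * η *
      ((v.re * (1 + 1 / ((γ 1 0 : ℝ) ^ 2 * Complex.normSq (v : ℂ))) : ℝ) : ℂ))) _

/-- **Support of the off-diagonal kernel**: if `K_c(v) ≠ 0` then `Y₁ ≤ Im v ≤ Y₂`,
`Y₁ c² |v|² ≤ Im v` and hence `|Re v| ≤ (Y₂/Y₁)^{1/2}/c` (for a profile supported in `[Y₁, Y₂]`,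
`Y₁ > 0`, `c > 0`). [folklore] -/
theorem offDiagKernel_support {Φ : ℝ → ℂ} {η : ℤ} {c Y₁ Y₂ : ℝ} (hc : 0 < c) (hY₁ : 0 < Y₁)
    (hsupp : ∀ y : ℝ, Φ y ≠ 0 → Y₁ ≤ y ∧ y ≤ Y₂) (v : ℍ)
    (hv : conj (Φ (v.im / (c ^ 2 * Complex.normSq (v : ℂ)))) * Φ v.im *
      Complex.exp (2 * π * Complex.I * η * ((v.re * (1 + 1 / (c ^ 2 * Complex.normSq (v : ℂ))) : ℝ) : ℂ)) ≠ 0) :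
    Y₁ ≤ v.im ∧ v.im ≤ Y₂ ∧ Y₁ * (c ^ 2 * Complex.normSq (v : ℂ)) ≤ v.im ∧
      |v.re| ≤ Real.sqrt (Y₂ / Y₁) / c := by
  have h1 : Φ v.im ≠ 0 := fun h => hv (by rw [h, mul_zero, zero_mul])
  have h2 : Φ (v.im / (c ^ 2 * Complex.normSq (v : ℂ))) ≠ 0 := fun h => hv (by rw [h, map_zero, zero_mul, zero_mul])
  obtain ⟨hy1, hy2⟩ := hsupp _ h1
  obtain ⟨hq1, -⟩ := hsupp _ h2
  have hN : 0 < Complex.normSq (v : ℂ) := Complex.normSq_pos.2 (UpperHalfPlane.ne_zero v)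
  have hcN : 0 < c ^ 2 * Complex.normSq (v : ℂ) := by positivity
  have h3 : Y₁ * (c ^ 2 * Complex.normSq (v : ℂ)) ≤ v.im := (le_div_iff₀ hcN).1 hq1
  refine ⟨hy1, hy2, h3, ?_⟩
  -- `Re v² ≤ |v|² ≤ Y₂/(Y₁ c²)`
  have hNeq : Complex.normSq (v : ℂ) = v.re ^ 2 + v.im ^ 2 := by
    rw [Complex.normSq_apply, UpperHalfPlane.coe_re, UpperHalfPlane.coe_im]; ring
  have h4 : Complex.normSq (v : ℂ) ≤ Y₂ / Y₁ / c ^ 2 := by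
    rw [le_div_iff₀ (by positivity), le_div_iff₀ hY₁]
    nlinarith
  have h5 : v.re ^ 2 ≤ Y₂ / Y₁ / c ^ 2 := by nlinarith [sq_nonneg v.im]
  have h6 := Real.abs_le_sqrt h5
  rwa [Real.sqrt_div' _ (sq_nonneg c), Real.sqrt_sq hc.le] at h6

/-- **The bound for `I_c`**: `|∫_ℍ K_c dμ| ≤ B² · (2 (Y₂/Y₁)^{1/2}/c) (Y₂ - Y₁)/Y₁²` for a profile
bounded by `B` and supported in `[Y₁, Y₂]` (`K_c` is bounded by `B²` and lives on the coordinate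
rectangle `|Re v| ≤ (Y₂/Y₁)^{1/2}/c`, `Y₁ ≤ Im v ≤ Y₂`). [cite: DukeFriedlanderIwaniec1995, §3 (22)–(23)] -/
theorem norm_integral_offDiagKernel_le {Φ : ℝ → ℂ} (η : ℤ) {c Y₁ Y₂ B : ℝ} (hc : 0 < c) (hY₁ : 0 < Y₁)
    (hY : Y₁ ≤ Y₂) (hsupp : ∀ y : ℝ, Φ y ≠ 0 → Y₁ ≤ y ∧ y ≤ Y₂) (hbd : ∀ y : ℝ, ‖Φ y‖ ≤ B) :
    ‖∫ v : ℍ, conj (Φ (v.im / (c ^ 2 * Complex.normSq (v : ℂ)))) * Φ v.im *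
        Complex.exp (2 * π * Complex.I * η * ((v.re * (1 + 1 / (c ^ 2 * Complex.normSq (v : ℂ))) : ℝ) : ℂ))‖ ≤
      B ^ 2 * ((2 * Real.sqrt (Y₂ / Y₁) / c) * (Y₂ - Y₁) / Y₁ ^ 2) := by
  set ρ := Real.sqrt (Y₂ / Y₁) with hρ
  set K : ℍ → ℂ := fun v => conj (Φ (v.im / (c ^ 2 * Complex.normSq (v : ℂ)))) * Φ v.im *
    Complex.exp (2 * π * Complex.I * η * ((v.re * (1 + 1 / (c ^ 2 * Complex.normSq (v : ℂ))) : ℝ) : ℂ))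
    with hK
  set R : Set ℍ := ((↑) : ℍ → ℂ) ⁻¹' (Icc (-ρ / c) (ρ / c) ×ℂ Icc Y₁ Y₂) with hR
  have hRm : MeasurableSet R := UpperHalfPlane.measurable_coe
    ((measurableSet_Icc.preimage measurable_re).inter (measurableSet_Icc.preimage measurable_im))
  have hρ0 : 0 ≤ ρ := Real.sqrt_nonneg _
  have hvol := volume_coe_preimage_reProdIm_le Y₂ (show -ρ / c ≤ ρ / c by
    apply div_le_div_of_nonneg_right _ hc.le; linarith) hY₁
  have hvol' : volume R < ⊤ := lt_of_le_of_lt hvol ENNReal.ofReal_lt_top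
  have hB0 : 0 ≤ B := (norm_nonneg _).trans (hbd 0)
  -- `‖K‖ ≤ B² 𝟙_R`
  have hle : ∀ v : ℍ, ‖K v‖ ≤ R.indicator (fun _ => B ^ 2) v := by
    intro v
    by_cases h : K v = 0
    · rw [h, norm_zero]; exact indicator_nonneg (fun _ _ => sq_nonneg B) v
    · obtain ⟨hy1, hy2, -, hre⟩ := offDiagKernel_support (η := η) hc hY₁ hsupp v h
      have hre' := abs_le.1 hre
      have hmem : v ∈ R := by
        refine ⟨⟨?_, ?_⟩, hy1, hy2⟩
        · rw [UpperHalfPlane.coe_re, neg_div]; exact hre'.1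
        · rw [UpperHalfPlane.coe_re]; exact hre'.2
      rw [indicator_of_mem hmem]
      simp only [hK]
      rw [norm_mul, norm_mul, Complex.norm_conj, norm_exp_two_pi_mul_I_mul, mul_one]
      exact (mul_le_mul (hbd _) (hbd _) (norm_nonneg _) hB0).trans_eq (sq B).symm
  have hint : Integrable (R.indicator fun _ => (B ^ 2 : ℝ)) (volume : Measure ℍ) :=
    (integrable_indicator_iff hRm).2 (integrableOn_const hvol'.ne)
  calc ‖∫ v, K v‖ ≤ ∫ v, ‖K v‖ := norm_integral_le_integral_norm _
    _ ≤ ∫ v, R.indicator (fun _ => (B ^ 2 : ℝ)) v :=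
        integral_mono_of_nonneg (Eventually.of_forall fun v => norm_nonneg _) hint
          (Eventually.of_forall hle)
    _ = B ^ 2 * (volume R).toReal := by
        rw [integral_indicator_const _ hRm, smul_eq_mul, mul_comm]; rfl
    _ ≤ B ^ 2 * ((2 * ρ / c) * (Y₂ - Y₁) / Y₁ ^ 2) := by
        refine mul_le_mul_of_nonneg_left ?_ (sq_nonneg B)
        have := ENNReal.toReal_mono ENNReal.ofReal_ne_top hvol
        have hw : 0 ≤ ρ / c - -ρ / c := by
          rw [sub_nonneg]; exact div_le_div_of_nonneg_right (by linarith) hc.le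
        have hnn : 0 ≤ (ρ / c - -ρ / c) * (Y₂ - Y₁) / Y₁ ^ 2 :=
          div_nonneg (mul_nonneg hw (by linarith)) (sq_nonneg _)
        rw [ENNReal.toReal_ofReal hnn] at this
        refine this.trans (le_of_eq ?_)
        ring

/-- **`I_c = 0` for `c > 1/Y₁`**: the off-diagonal kernel vanishes identically once `c Y₁ > 1`
(`Y₁ c² |v|² ≤ Im v` forces `(c Y₁)² ≤ c² Y₁ Im v ≤ 1`). [cite: DukeFriedlanderIwaniec1995, §3] -/
theorem integral_offDiagKernel_eq_zero {Φ : ℝ → ℂ} (η : ℤ) {c Y₁ Y₂ : ℝ} (hc : 0 < c) (hY₁ : 0 < Y₁)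
    (hcY : 1 < c * Y₁) (hsupp : ∀ y : ℝ, Φ y ≠ 0 → Y₁ ≤ y ∧ y ≤ Y₂) :
    ∫ v : ℍ, conj (Φ (v.im / (c ^ 2 * Complex.normSq (v : ℂ)))) * Φ v.im *
        Complex.exp (2 * π * Complex.I * η * ((v.re * (1 + 1 / (c ^ 2 * Complex.normSq (v : ℂ))) : ℝ) : ℂ)) = 0 := by
  refine (integral_congr_ae (Eventually.of_forall fun v => ?_)).trans (integral_zero _ _)
  by_contra h
  obtain ⟨hy1, -, h3, -⟩ := offDiagKernel_support (η := η) hc hY₁ hsupp v h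
  have hNeq : Complex.normSq (v : ℂ) = v.re ^ 2 + v.im ^ 2 := by
    rw [Complex.normSq_apply, UpperHalfPlane.coe_re, UpperHalfPlane.coe_im]; ring
  have hvim : 0 < v.im := v.im_pos
  -- `Y₁ c² Im v ≤ 1`
  have h4 : Y₁ * c ^ 2 * v.im ^ 2 ≤ v.im := by
    rw [hNeq] at h3
    have : Y₁ * c ^ 2 * v.im ^ 2 ≤ Y₁ * (c ^ 2 * (v.re ^ 2 + v.im ^ 2)) := by
      have h0 : (0 : ℝ) ≤ Y₁ * c ^ 2 := by positivity
      nlinarith [mul_nonneg h0 (sq_nonneg v.re)]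
    exact this.trans h3
  have h5 : Y₁ * c ^ 2 * v.im ≤ 1 := by
    by_contra h6
    rw [not_le] at h6
    have := mul_lt_mul_of_pos_left h6 hvim
    nlinarith
  have h7 : (c * Y₁) ^ 2 ≤ 1 := by
    have : Y₁ * c ^ 2 * Y₁ ≤ Y₁ * c ^ 2 * v.im := mul_le_mul_of_nonneg_left hy1 (by positivity)
    nlinarith
  nlinarith

/-! ### Summing over `d mod c`: the Kloosterman sum -/

/-- For `γ = (a b; c d) ∈ SL₂(ℤ)`: `a d ≡ 1 (mod c)`. [folklore] -/
theorem sl_mul_eq_one_zmod (γ : SL(2, ℤ)) {c : ℕ} (hc : γ 1 0 = c) :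
    ((γ 0 0 : ℤ) : ZMod c) * ((γ 1 1 : ℤ) : ZMod c) = 1 := by
  have hdet := γ.det_coe
  rw [Matrix.det_fin_two, hc] at hdet
  have : (((γ 0 0 * γ 1 1 - γ 0 1 * c : ℤ) : ZMod c)) = 1 := by rw [hdet]; simp
  push_cast at this
  rw [ZMod.natCast_self] at this
  simpa using this

/-- **The phases sum to the Kloosterman sum**: for matrices `γ_d = (a_d ∗; c d)` attached to the
`d ∈ [0, c)` prime to `c`,  `∑_d e(-η(a_d + d)/c) = S(-η, -η; c)` (`a_d ≡ d⁻¹ (mod c)`).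
[cite: Iwaniec2002, (2.23) and §3.2; DukeFriedlanderIwaniec1995, (21)] -/
theorem sum_phase_eq_kloostermanSum (η : ℤ) {c : ℕ} [NeZero c] (Γd : ℕ → SL(2, ℤ))
    (hΓd : ∀ d : ℕ, d < c → Nat.Coprime c d → (Γd d) 1 0 = c ∧ (Γd d) 1 1 = d) :
    ∑ d ∈ (Finset.range c).filter (fun d => Nat.Coprime c d),
        Complex.exp (2 * π * Complex.I * ((-η : ℤ) : ℂ) *
          (((((Γd d) 0 0 : ℝ) + (Γd d) 1 1) / ((Γd d) 1 0 : ℝ) : ℝ) : ℂ)) =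
      kloostermanSum c ((-η : ℤ) : ZMod c) ((-η : ℤ) : ZMod c) := by
  classical
  unfold kloostermanSum
  rw [sum_zmod_eq_sum_range, ← Finset.sum_filter_add_sum_filter_not (Finset.range c) (fun d => Nat.Coprime c d)]
  have hzero : ∑ d ∈ (Finset.range c).filter (fun d => ¬ Nat.Coprime c d),
      (if IsUnit ((d : ℕ) : ZMod c) then
        (ZMod.stdAddChar (((-η : ℤ) : ZMod c) * (d : ZMod c) + ((-η : ℤ) : ZMod c) * ((d : ZMod c))⁻¹) : ℂ)
        else 0) = 0 := by
    refine Finset.sum_eq_zero fun d hd => ?_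
    rw [Finset.mem_filter] at hd
    rw [if_neg]
    rw [ZMod.isUnit_iff_coprime, Nat.coprime_comm]
    exact hd.2
  rw [hzero, add_zero]
  refine Finset.sum_congr rfl fun d hd => ?_
  rw [Finset.mem_filter, Finset.mem_range] at hd
  obtain ⟨hdc, hcop⟩ := hd
  obtain ⟨h0, h1⟩ := hΓd d hdc hcop
  have hunit : IsUnit ((d : ℕ) : ZMod c) := (ZMod.isUnit_iff_coprime d c).2 hcop.symm
  rw [if_pos hunit]
  -- `d⁻¹ = a_d`
  have hinv : ((d : ℕ) : ZMod c)⁻¹ = (((Γd d) 0 0 : ℤ) : ZMod c) := by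
    apply ZMod.inv_eq_of_mul_eq_one
    have h := sl_mul_eq_one_zmod (Γd d) h0
    rw [h1] at h
    push_cast at h
    rw [mul_comm] at h
    exact h
  rw [hinv]
  have e : ((-η : ℤ) : ZMod c) * (d : ZMod c) + ((-η : ℤ) : ZMod c) * (((Γd d) 0 0 : ℤ) : ZMod c) =
      (((-η) * ((Γd d) 0 0 + d) : ℤ) : ZMod c) := by push_cast; ring
  rw [e, ZMod.stdAddChar_coe, h0, h1]
  congr 1
  push_cast
  ring

/-- **Weil's bound** for `S(-η, -η; c)`: `|S(-η,-η;c)| ≤ (η, c)^{1/2} c^{1/2} τ(c)` (the tree's proved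
`weil_kloosterman_bound_holds`). [cite: Iwaniec2002, (2.25)] -/
theorem norm_kloostermanSum_neg_neg_le (η : ℤ) (c : ℕ) [NeZero c] :
    ‖kloostermanSum c ((-η : ℤ) : ZMod c) ((-η : ℤ) : ZMod c)‖ ≤
      Real.sqrt (Nat.gcd η.natAbs c) * Real.sqrt c * (Nat.divisors c).card := by
  have h := weil_kloosterman_bound_holds c (-η) (-η)
  rwa [Int.natAbs_neg, Nat.gcd_self] at h

/-- **The off-diagonal term for a fixed `c`**: for the strip kernel `ψ`, matrices `γ_d` with bottom
rows `(c, d)`, `0 ≤ d < c`, `(c, d) = 1`: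
`|∑_d ∫_ℍ conj(ψ ∘ γ_d) ψ dμ| ≤ (η,c)^{1/2} c^{1/2} τ(c) · |I_c|`.
[cite: DukeFriedlanderIwaniec1995, §3 (21)–(23)] -/
theorem norm_sum_integral_conj_stripKernel_smul_mul_le (Φ : ℝ → ℂ) (η : ℤ) {c : ℕ} [NeZero c]
    (Γd : ℕ → SL(2, ℤ)) (hΓd : ∀ d : ℕ, d < c → Nat.Coprime c d → (Γd d) 1 0 = c ∧ (Γd d) 1 1 = d) :
    ‖∑ d ∈ (Finset.range c).filter (fun d => Nat.Coprime c d),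
        ∫ w : ℍ, conj (Φ (Γd d • w).im * Complex.exp (2 * π * Complex.I * η * ((Γd d • w).re : ℂ))) *
          (Φ w.im * Complex.exp (2 * π * Complex.I * η * (w.re : ℂ)))‖ ≤
      Real.sqrt (Nat.gcd η.natAbs c) * Real.sqrt c * (Nat.divisors c).card *
        ‖∫ v : ℍ, conj (Φ (v.im / ((c : ℝ) ^ 2 * Complex.normSq (v : ℂ)))) * Φ v.im *
          Complex.exp (2 * π * Complex.I * η *
            ((v.re * (1 + 1 / ((c : ℝ) ^ 2 * Complex.normSq (v : ℂ))) : ℝ) : ℂ))‖ := by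
  have hc0 : (c : ℤ) ≠ 0 := by exact_mod_cast (NeZero.ne c)
  -- each integral is `e(d) I_c`
  have hterm : ∀ d ∈ (Finset.range c).filter (fun d => Nat.Coprime c d),
      ∫ w : ℍ, conj (Φ (Γd d • w).im * Complex.exp (2 * π * Complex.I * η * ((Γd d • w).re : ℂ))) *
          (Φ w.im * Complex.exp (2 * π * Complex.I * η * (w.re : ℂ))) =
        Complex.exp (2 * π * Complex.I * ((-η : ℤ) : ℂ) *
          (((((Γd d) 0 0 : ℝ) + (Γd d) 1 1) / ((Γd d) 1 0 : ℝ) : ℝ) : ℂ)) *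
        ∫ v : ℍ, conj (Φ (v.im / ((c : ℝ) ^ 2 * Complex.normSq (v : ℂ)))) * Φ v.im *
          Complex.exp (2 * π * Complex.I * η *
            ((v.re * (1 + 1 / ((c : ℝ) ^ 2 * Complex.normSq (v : ℂ))) : ℝ) : ℂ)) := by
    intro d hd
    rw [Finset.mem_filter, Finset.mem_range] at hd
    obtain ⟨h0, -⟩ := hΓd d hd.1 hd.2
    have hc' : (Γd d) 1 0 ≠ 0 := by rw [h0]; exact hc0
    rw [integral_conj_stripKernel_smul_mul_eq Φ η (Γd d) hc', h0]
    rfl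
  rw [Finset.sum_congr rfl hterm, ← Finset.sum_mul, norm_mul, sum_phase_eq_kloostermanSum η Γd hΓd]
  exact mul_le_mul_of_nonneg_right (norm_kloostermanSum_neg_neg_le η c) (norm_nonneg _)

end DFI1995

end Literature.NumberTheory.Sieve
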